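import Summits.ValiantsHypothesis.ValiantsHypothesis.Theses.FermionizationDimension
import Summits.ValiantsHypothesis.ValiantsHypothesis.Theorems.FermionizationDimensionSDimPerNotQPLocalExpansion

/-!
# Route FermionizationDimension — crux `SDimPerNotQP` (stmt-ValiantsHypothesis-7286):
# calibration G — the global expansion bound

Auxiliary registered stub `stub_globalExpansion` of the line `registered` of
`Cruxes/SDimPerNotQP/Lines/birth.lean` (calibration of the transfer stub J_tr, not a hypothesis of
the composition). Over ANY finite-dimensional commutative `ℂ`-algebra `R` with `d = finrank ℂ R`,
twists `u : Fin n → Fin n → R` and a functional `ℓ`, the pattern `σ ↦ ℓ (∏ i, u (σ i) i)` on `𝔖ₙ`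
is a scalar combination of at most `(n+1)^d · d^d` transversal product patterns
`σ ↦ ∏ i, E (σ i) i` — "nilpotents buy at most an exponential-in-`d` factor over idempotents",
the honest (point-evaluation / junta-expansion) content of junk rigidity; the line's bet J_tr
claims quasi-polynomial cost instead.

Proof. `R` is Artinian (`IsArtinianRing.of_finite`), its nilradical is nilpotent, so by the
Chinese remainder theorem `R ≅ Π_I R ⧸ I^(k+1)` over the finitely many maximal ideals
(`IsArtinianRing.quotNilradicalPowEquivPi`). Each factor is local with a character
(reduce modulo `I`; the residue field is `ℂ`) and every element differs from its character value by
a nilpotent (`exists_localChar`), so the landed local expansion bound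
`stub_localExpansion` (Theorems/FermionizationDimensionSDimPerNotQPLocalExpansion.lean) applies
factor by factor after splitting `ℓ = Σ_I ℓ ∘ e⁻¹ ∘ ι_I`; the counts add up as
`Σ_I ((n+1) d)^(d_I) ≤ ((n+1) d)^(Σ_I d_I) = (n+1)^d d^d` (`sum_pow_le_pow_sum`; the degenerate case
`(n+1) d ≤ 1` has at most one maximal ideal).

Sources: folklore (structure of commutative Artinian rings; Chinese remainder theorem).
-/

set_option linter.dupNamespace false

namespace Summit.ValiantsHypothesis.ValiantsHypothesis.Theorems

namespace FermionizationDimensionSDimPerNotQPGlobalExpansion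

open Finset

/-- Sum versus power: for `x ≥ 2` and exponents `≥ 1`, `Σ_(i ∈ s) x^(f i) ≤ x^(Σ_(i ∈ s) f i)`.
[folklore] -/
theorem sum_pow_le_pow_sum {ι : Type*} (s : Finset ι) (f : ι → ℕ) (x : ℕ) (hx : 2 ≤ x)
    (hf : ∀ i ∈ s, 1 ≤ f i) : ∑ i ∈ s, x ^ f i ≤ x ^ ∑ i ∈ s, f i := by
  classical
  induction s using Finset.induction_on with
  | empty => simp
  | @insert a s ha ih =>
    rw [Finset.sum_insert ha, Finset.sum_insert ha, pow_add]
    have hfa : 1 ≤ f a := hf a (Finset.mem_insert_self a s)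
    have ih' := ih fun i hi => hf i (Finset.mem_insert_of_mem hi)
    have h2 : 2 ≤ x ^ f a := le_trans hx (Nat.le_self_pow (by omega) x)
    rcases s.eq_empty_or_nonempty with rfl | hne
    · simp
    · obtain ⟨i, hi⟩ := hne
      have hfi : 1 ≤ ∑ j ∈ s, f j :=
        le_trans (hf i (Finset.mem_insert_of_mem hi)) (Finset.single_le_sum (fun _ _ => Nat.zero_le _) hi)
      have hb : 2 ≤ x ^ ∑ j ∈ s, f j := le_trans hx (by
        calc x = x ^ 1 := (pow_one x).symm
          _ ≤ x ^ ∑ j ∈ s, f j := Nat.pow_le_pow_right (by omega) hfi)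
      calc x ^ f a + ∑ i ∈ s, x ^ f i ≤ x ^ f a + x ^ ∑ i ∈ s, f i := by omega
        _ ≤ x ^ f a * x ^ ∑ i ∈ s, f i := by nlinarith

/-- **Characters of the local factors.** For a maximal ideal `I` of a finite-dimensional
commutative `ℂ`-algebra `R` and `m ≠ 0`, the local factor `R ⧸ I^m` carries a character
`χ : R ⧸ I^m →ₐ[ℂ] ℂ` (reduce modulo `I`; the residue field, finite over the algebraically closed
`ℂ`, is `ℂ`) and every element differs from its character value by a nilpotent (an element of
`I / I^m`). [folklore] -/
theorem exists_localChar {R : Type} [CommRing R] [Algebra ℂ R] [Module.Finite ℂ R]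
    (I : MaximalSpectrum R) {m : ℕ} (hm : m ≠ 0) :
    ∃ χ : (R ⧸ I.asIdeal ^ m) →ₐ[ℂ] ℂ,
      ∀ a : R ⧸ I.asIdeal ^ m, IsNilpotent (a - algebraMap ℂ (R ⧸ I.asIdeal ^ m) (χ a)) := by
  -- the residue field is `ℂ`
  let ρ : (R ⧸ I.asIdeal) ≃ₐ[ℂ] ℂ :=
    (AlgEquiv.ofBijective (Algebra.ofId ℂ (R ⧸ I.asIdeal))
      IsAlgClosed.algebraMap_bijective_of_isIntegral).symm
  let χ : (R ⧸ I.asIdeal ^ m) →ₐ[ℂ] ℂ :=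
    ρ.toAlgHom.comp (Ideal.Quotient.factorₐ ℂ (Ideal.pow_le_self hm))
  refine ⟨χ, fun a => ?_⟩
  obtain ⟨x, rfl⟩ := Ideal.Quotient.mk_surjective a
  set c : ℂ := χ (Ideal.Quotient.mk (I.asIdeal ^ m) x) with hc
  -- `x - c • 1 ∈ I`
  have hxI : x - algebraMap ℂ R c ∈ I.asIdeal := by
    rw [← Ideal.Quotient.eq_zero_iff_mem, map_sub, Ideal.Quotient.mk_algebraMap, sub_eq_zero]
    have h1 : ρ (Ideal.Quotient.mk I.asIdeal x) = c := by
      rw [hc]; rfl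
    have h2 := congrArg ρ.symm h1
    rw [AlgEquiv.symm_apply_apply] at h2
    rw [h2]
    simpa using ρ.symm.commutes c
  refine ⟨m, ?_⟩
  rw [← Ideal.Quotient.mk_algebraMap, ← map_sub, ← map_pow, Ideal.Quotient.eq_zero_iff_mem]
  exact Ideal.pow_mem_pow hxI m

/-- **Calibration G — the global expansion bound** (auxiliary registered stub
`stub_globalExpansion` of the line `registered` of crux `SDimPerNotQP`, stmt-ValiantsHypothesis-7286).
Over any finite-dimensional commutative `ℂ`-algebra `R`, `d = finrank ℂ R`, every pattern
`σ ↦ ℓ (∏ i, u (σ i) i)` is a scalar combination of at most `(n+1)^d · d^d` transversal product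
patterns. Proof: `R` is Artinian, `(nilradical R)^k = 0`, so
`R ≅ Π_I R ⧸ I^k` over the maximal ideals (`IsArtinianRing.quotNilradicalPowEquivPi`); split `ℓ`
along the factors, apply the local expansion bound (`stub_localExpansion`) to each local factor with
its character (`exists_localChar`), and sum: `Σ_I ((n+1) d)^(d_I) ≤ ((n+1) d)^d`. [folklore] -/
theorem stub_globalExpansion :
    ∀ (n : ℕ) (R : Type) [CommRing R] [Algebra ℂ R] [Module.Finite ℂ R] (u : Fin n → Fin n → R) (ℓ : R →ₗ[ℂ] ℂ), ∃ (T : Type) (_ : Fintype T) (c : T → ℂ) (E : T → Fin n → Fin n → ℂ), Fintype.card T ≤ (n + 1) ^ Module.finrank ℂ R * Module.finrank ℂ R ^ Module.finrank ℂ R ∧ ∀ σ : Equiv.Perm (Fin n), ℓ (∏ i, u (σ i) i) = ∑ t, c t * ∏ i, E t (σ i) i := by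
  intro n R _ _ _ u ℓ
  classical
  haveI : IsArtinianRing R := IsArtinianRing.of_finite ℂ R
  letI : Fintype (MaximalSpectrum R) := Fintype.ofFinite _
  obtain ⟨k, hk⟩ := IsArtinianRing.isNilpotent_nilradical (R := R)
  have hk1 : nilradical R ^ (k + 1) = ⊥ := by
    rw [← le_bot_iff, ← Ideal.zero_eq_bot, ← hk]
    exact Ideal.pow_le_pow_right (Nat.le_succ k)
  have hm : k + 1 ≠ 0 := Nat.succ_ne_zero k
  -- the CRT decomposition into local factors
  let e : R ≃ₐ[ℂ] (∀ I : MaximalSpectrum R, R ⧸ I.asIdeal ^ (k + 1)) :=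
    (((AlgEquiv.quotientBot R R).symm.trans (Ideal.quotientEquivAlgOfEq R hk1.symm)).trans
      (IsArtinianRing.quotNilradicalPowEquivPi R (k + 1))).restrictScalars ℂ
  -- split `u` and `ℓ` along the factors
  let uI : ∀ I : MaximalSpectrum R, Fin n → Fin n → R ⧸ I.asIdeal ^ (k + 1) :=
    fun I a b => e (u a b) I
  let ℓI : ∀ I : MaximalSpectrum R, (R ⧸ I.asIdeal ^ (k + 1)) →ₗ[ℂ] ℂ :=
    fun I => ℓ ∘ₗ e.symm.toLinearMap ∘ₗ
      LinearMap.single ℂ (fun J : MaximalSpectrum R => R ⧸ J.asIdeal ^ (k + 1)) I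
  have hsplit : ∀ σ : Equiv.Perm (Fin n),
      ℓ (∏ i, u (σ i) i) = ∑ I, ℓI I (∏ i, uI I (σ i) i) := by
    intro σ
    have hx : (∏ i, u (σ i) i) = e.symm (∑ I, Pi.single I (e (∏ i, u (σ i) i) I)) := by
      rw [Finset.univ_sum_single, AlgEquiv.symm_apply_apply]
    rw [hx, map_sum, map_sum]
    refine Finset.sum_congr rfl fun I _ => ?_
    simp only [ℓI, uI, LinearMap.coe_comp, Function.comp_apply, LinearMap.coe_single,
      AlgEquiv.toLinearMap_apply, map_prod, Finset.prod_apply]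
  -- local expansion on each factor, with its character
  choose χ hχ using fun I : MaximalSpectrum R => exists_localChar I hm
  have hloc := fun I : MaximalSpectrum R =>
    Summit.ValiantsHypothesis.ValiantsHypothesis.Theorems.stub_localExpansion n
      (R ⧸ I.asIdeal ^ (k + 1)) (χ I) (hχ I) (uI I) (ℓI I)
  choose T instT c E hcard hrep using hloc
  letI : ∀ I, Fintype (T I) := instT
  refine ⟨(Σ I : MaximalSpectrum R, T I), inferInstance, fun p => c p.1 p.2, fun p => E p.1 p.2,
    ?_, fun σ => ?_⟩
  · -- the count
    set d := Module.finrank ℂ R with hd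
    have hdI_sum : ∑ I : MaximalSpectrum R, Module.finrank ℂ (R ⧸ I.asIdeal ^ (k + 1)) = d := by
      rw [hd, e.toLinearEquiv.finrank_eq, Module.finrank_pi_fintype]
    have hdI_pos : ∀ I : MaximalSpectrum R, 1 ≤ Module.finrank ℂ (R ⧸ I.asIdeal ^ (k + 1)) := by
      intro I
      haveI : Nontrivial (R ⧸ I.asIdeal ^ (k + 1)) :=
        Ideal.Quotient.nontrivial_iff.2 (fun h => I.isMaximal.ne_top
          (top_le_iff.1 (h ▸ Ideal.pow_le_self hm : (⊤ : Ideal R) ≤ I.asIdeal)))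
      exact Module.finrank_pos
    have hdI_le : ∀ I : MaximalSpectrum R, Module.finrank ℂ (R ⧸ I.asIdeal ^ (k + 1)) ≤ d :=
      fun I => hdI_sum ▸ Finset.single_le_sum
        (f := fun J : MaximalSpectrum R => Module.finrank ℂ (R ⧸ J.asIdeal ^ (k + 1)))
        (fun J _ => Nat.zero_le _) (Finset.mem_univ I)
    have hcardI : Fintype.card (MaximalSpectrum R) ≤ d := by
      calc Fintype.card (MaximalSpectrum R) = ∑ I : MaximalSpectrum R, 1 := by simp
        _ ≤ ∑ I : MaximalSpectrum R, Module.finrank ℂ (R ⧸ I.asIdeal ^ (k + 1)) :=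
          Finset.sum_le_sum fun I _ => hdI_pos I
        _ = d := hdI_sum
    rw [Fintype.card_sigma]
    -- each term
    have hterm : ∀ I : MaximalSpectrum R,
        Fintype.card (T I) ≤ ((n + 1) * d) ^ Module.finrank ℂ (R ⧸ I.asIdeal ^ (k + 1)) := by
      intro I
      refine (hcard I).trans ?_
      rw [mul_pow]
      exact Nat.mul_le_mul_left _ (Nat.pow_le_pow_left (hdI_le I) _)
    refine (Finset.sum_le_sum fun I _ => hterm I).trans ?_
    rw [← mul_pow]
    by_cases hx : 2 ≤ (n + 1) * d
    · have h := sum_pow_le_pow_sum Finset.univ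
        (fun I : MaximalSpectrum R => Module.finrank ℂ (R ⧸ I.asIdeal ^ (k + 1))) ((n + 1) * d) hx
        fun I _ => hdI_pos I
      rwa [hdI_sum] at h
    · -- `(n+1) d ≤ 1`: then `d ≤ 1`, at most one maximal ideal
      have hd1 : d ≤ 1 := by
        by_contra h
        exact hx (le_trans (by omega) (Nat.le_mul_of_pos_left d (Nat.succ_pos n)))
      have hc1 : Fintype.card (MaximalSpectrum R) ≤ 1 := hcardI.trans hd1
      rcases Nat.le_one_iff_eq_zero_or_eq_one.1 hc1 with h0 | h1
      · haveI : IsEmpty (MaximalSpectrum R) := Fintype.card_eq_zero_iff.1 h0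
        simp
      · obtain ⟨I₀, hI₀⟩ := Fintype.card_eq_one_iff.1 h1
        have huniv : (Finset.univ : Finset (MaximalSpectrum R)) = {I₀} := by
          ext J; simp [hI₀ J]
        have hsum1 : Module.finrank ℂ (R ⧸ I₀.asIdeal ^ (k + 1)) = d := by
          rw [← hdI_sum, huniv, Finset.sum_singleton]
        rw [huniv, Finset.sum_singleton, hsum1]
  · -- the representation
    rw [hsplit σ, Fintype.sum_sigma]
    exact Finset.sum_congr rfl fun I _ => hrep I σ

end FermionizationDimensionSDimPerNotQPGlobalExpansion

end Summit.ValiantsHypothesis.ValiantsHypothesis.Theorems
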